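import Mathlib.RingTheory.Valuation.ValuationSubring
import Mathlib.RingTheory.DiscreteValuationRing.Basic
import Mathlib.Data.Fin.VecNotation
import HarnessLib

/-!
# A Noetherian valuation ring carries a discrete chain of coarsenings of length `≤ 1`
# (crux `IndSmooth.ValuativeSmoothing`, line `birth`, stub `stub_discreteChainOfNoetherian`)

Stub `stub_discreteChainOfNoetherian` of the skeleton `Lines/birth.lean` (lead reshape r8) for crux
stmt-ResolutionOfSingularities-16087. The discrete-jumps family of the line
(`smoothFactor_of_discreteJumps`, file `IndSmoothValuativeSmoothingDiscreteJumps.lean`) consumes a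
chain `O = O₀ ≤ O₁ ≤ ⋯ ≤ O_N = K` of valuation subrings of a field `K` with nonzero
`e_i ∈ O_i`, `𝔪_{O_i} = e_i O_i` and `O_{i+1} = O_i[1/e_i]`. This file folds the NOETHERIAN family
into it: a Noetherian valuation subring `O` of `K` is

* either all of `K` — then the chain of length `N = 0`, `O₀ = K`, does it;
* or a discrete valuation ring — a valuation ring is Bézout, Noetherian Bézout is principal, and a
  local principal ideal domain which is not a field is a discrete valuation ring; then the chain of
  length `N = 1`, `O₀ = O ≤ O₁ = K` with `e₀ = ϖ` a uniformizer, does it: `𝔪_O = ϖ O`, and every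
  `x ∈ K` has `ϖ ^ n x ∈ O` for some `n` (if `x ∉ O` then `x⁻¹ ∈ O` is `u ϖ ^ m` with `u` a unit,
  so `ϖ ^ m x = u⁻¹ ∈ O`).

The dichotomy is decided by whether `𝔪_O = ⊥`: if so, `O` is a field, and a valuation subring
which is a field is all of `K` (for `x ∉ O`, `x⁻¹ ∈ O` is nonzero, hence invertible in `O`, so
`x ∈ O`).

* `exists_discreteChain_of_uniformizer` — the length-one chain attached to a uniformizer;
* `eq_top_of_maximalIdeal_eq_bot` — a valuation subring with zero maximal ideal is `⊤`;
* `stub_discreteChainOfNoetherian` — the stub, verbatim.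

Pure Mathlib algebra (`ValuationSubring`, `IsDiscreteValuationRing`); no named facts.
-/

-- single-problem summit: the doubled namespace component is forced
set_option linter.dupNamespace false

namespace Summit.ResolutionOfSingularities.ResolutionOfSingularities.Theorems.ValuativeSmoothing

/-- The discrete chain of length one attached to a "uniformizer": if `ϖ ∈ O` is nonzero,
generates the maximal ideal of the valuation subring `O` of `K`, and every `x ∈ K` satisfies
`ϖ ^ n x ∈ O` for some `n` (i.e. `K = O[1/ϖ]`), then `O = O₀ ≤ O₁ = K`, `e₀ = ϖ` is a chain of
coarsenings in the format of `smoothFactor_of_discreteJumps` (`N = 1`). [folklore] -/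
theorem exists_discreteChain_of_uniformizer {K : Type} [Field K] (O : ValuationSubring K)
    (ϖ : K) (hϖO : ϖ ∈ O) (hϖ0 : ϖ ≠ 0)
    (hmax : IsLocalRing.maximalIdeal O = Ideal.span {(⟨ϖ, hϖO⟩ : O)})
    (hloc : ∀ x : K, ∃ n : ℕ, ϖ ^ n * x ∈ O) :
    ∃ (N : ℕ) (Os : Fin (N + 1) → ValuationSubring K) (e : Fin N → K)
      (he : ∀ i : Fin N, e i ∈ Os i.castSucc), (∀ i : Fin N, e i ≠ 0) ∧
      (∀ i : Fin N, IsLocalRing.maximalIdeal (Os i.castSucc) =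
        Ideal.span {(⟨e i, he i⟩ : Os i.castSucc)}) ∧
      (∀ (i : Fin N) (x : K), x ∈ Os i.succ ↔ ∃ n : ℕ, e i ^ n * x ∈ Os i.castSucc) ∧
      Os (Fin.last N) = ⊤ ∧ Os 0 = O := by
  refine ⟨1, ![O, ⊤], ![ϖ], Fin.forall_fin_one.2 hϖO, Fin.forall_fin_one.2 hϖ0,
    Fin.forall_fin_one.2 hmax, Fin.forall_fin_one.2 fun x => ?_, rfl, rfl⟩
  exact ⟨fun _ => hloc x, fun _ => ValuationSubring.mem_top x⟩

/-- A valuation subring `O` of a field `K` whose maximal ideal is zero (i.e. which is a field)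
is all of `K`: for `x ∉ O` one has `x⁻¹ ∈ O`, nonzero, hence invertible in `O`, so
`x = (x⁻¹)⁻¹ ∈ O`. [folklore] -/
theorem eq_top_of_maximalIdeal_eq_bot {K : Type} [Field K] (O : ValuationSubring K)
    (hbot : IsLocalRing.maximalIdeal O = ⊥) : O = ⊤ := by
  have hF : IsField O := IsLocalRing.isField_iff_maximalIdeal_eq.mpr hbot
  refine top_unique ?_
  intro x _
  rcases O.mem_or_inv_mem x with hx | hx
  · exact hx
  by_cases hx0 : x = 0
  · rw [hx0]
    exact zero_mem O
  have hy0 : (⟨x⁻¹, hx⟩ : O) ≠ 0 := fun h => inv_ne_zero hx0 (congrArg Subtype.val h)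
  obtain ⟨z, hz⟩ := hF.mul_inv_cancel hy0
  have hz' : x⁻¹ * (z : K) = 1 := by
    have := congrArg Subtype.val hz
    simpa using this
  have hxz : x = z := by
    rw [← inv_inv x]
    exact inv_eq_of_mul_eq_one_right hz'
  rw [hxz]
  exact z.2

/-- **Stub `stub_discreteChainOfNoetherian` (line `birth`, crux `IndSmooth.ValuativeSmoothing`,
r8).** A Noetherian valuation subring `O` of a field `K` admits a discrete chain of coarsenings
`O = O₀ ≤ ⋯ ≤ O_N = K` (nonzero `e_i ∈ O_i` generating `𝔪_{O_i}`, `O_{i+1} = O_i[1/e_i]`) of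
length `N ≤ 1`: if `𝔪_O = ⊥` then `O = K` (`eq_top_of_maximalIdeal_eq_bot`) and `N = 0`;
otherwise `O` is a discrete valuation ring (valuation ⇒ Bézout, Noetherian Bézout ⇒ principal,
local principal non-field ⇒ DVR), and a uniformizer `ϖ` gives the chain `O ≤ K` of length `1`
(`exists_discreteChain_of_uniformizer`; `K = O[1/ϖ]` because `x ∉ O` forces
`x⁻¹ = u ϖ ^ m ∈ O` with `u` a unit, whence `ϖ ^ m x = u⁻¹ ∈ O`). [folklore] -/
theorem stub_discreteChainOfNoetherian {K : Type} [Field K] (O : ValuationSubring K)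
    (hN : IsNoetherianRing O) :
    ∃ (N : ℕ) (Os : Fin (N + 1) → ValuationSubring K) (e : Fin N → K)
      (he : ∀ i : Fin N, e i ∈ Os i.castSucc), (∀ i : Fin N, e i ≠ 0) ∧
      (∀ i : Fin N, IsLocalRing.maximalIdeal (Os i.castSucc) =
        Ideal.span {(⟨e i, he i⟩ : Os i.castSucc)}) ∧
      (∀ (i : Fin N) (x : K), x ∈ Os i.succ ↔ ∃ n : ℕ, e i ^ n * x ∈ Os i.castSucc) ∧
      Os (Fin.last N) = ⊤ ∧ Os 0 = O := by
  classical
  by_cases hbot : IsLocalRing.maximalIdeal O = ⊥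
  · -- `O` is a field, hence `O = K`: the chain of length `0`
    have hO : O = ⊤ := eq_top_of_maximalIdeal_eq_bot O hbot
    exact ⟨0, fun _ => ⊤, fun i => i.elim0, fun i => i.elim0, fun i => i.elim0, fun i => i.elim0,
      fun i => i.elim0, rfl, hO.symm⟩
  · -- `O` is a discrete valuation ring: the chain of length `1` given by a uniformizer
    haveI := hN
    haveI : IsPrincipalIdealRing O := IsPrincipalIdealRing.of_isNoetherianRing_of_isBezout
    haveI : IsDiscreteValuationRing O := { not_a_field' := hbot }
    obtain ⟨ϖ, hϖ⟩ := IsDiscreteValuationRing.exists_irreducible O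
    have hmax : IsLocalRing.maximalIdeal O = Ideal.span {ϖ} := hϖ.maximalIdeal_eq
    have hϖ0 : (ϖ : K) ≠ 0 := fun h => hϖ.ne_zero (Subtype.ext h)
    have hloc : ∀ x : K, ∃ n : ℕ, (ϖ : K) ^ n * x ∈ O := by
      intro x
      rcases O.mem_or_inv_mem x with hx | hx
      · exact ⟨0, by simpa using hx⟩
      by_cases hx0 : x = 0
      · exact ⟨0, by simp [hx0]⟩
      have hy0 : (⟨x⁻¹, hx⟩ : O) ≠ 0 := fun h => inv_ne_zero hx0 (congrArg Subtype.val h)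
      obtain ⟨m, u, hu⟩ := IsDiscreteValuationRing.eq_unit_mul_pow_irreducible hy0 hϖ
      refine ⟨m, ?_⟩
      -- in `O`: `u⁻¹ x⁻¹ = ϖ ^ m`; in `K`: `ϖ ^ m x = u⁻¹ x⁻¹ x = u⁻¹ ∈ O`
      have hc : (((u⁻¹ : Oˣ) : O) : K) * x⁻¹ = (ϖ : K) ^ m := by
        have := congrArg (fun z : O => (z : K)) (u.inv_mul_eq_iff_eq_mul.mpr hu)
        simpa only [MulMemClass.coe_mul, SubmonoidClass.coe_pow] using this
      rw [← hc, inv_mul_cancel_right₀ hx0]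
      exact ((u⁻¹ : Oˣ) : O).2
    exact exists_discreteChain_of_uniformizer O (ϖ : K) ϖ.2 hϖ0 hmax hloc

end Summit.ResolutionOfSingularities.ResolutionOfSingularities.Theorems.ValuativeSmoothing
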